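import Literature.MathematicalPhysics.QuantumLattice.HeatKernelGroupPeterWeylProofs
import Literature.RepresentationTheory.CompactGroups.PointDerivations
import HarnessLib

/-!
# The generating functional of a heat kernel and the rescaling theorem (brick 5)

Fifth brick of the proof of
`Literature.MathematicalPhysics.QuantumLattice.isGroupHeatKernel_unique_up_to_scale` (Hunt 1956,
Thm 5.1 with Schur's lemma). For a heat kernel `p` of a compact Hausdorff group `G`
(`IsGroupHeatKernel p`) and the algebra `R = translationFinite G` of representative functions
with augmentation ideal `K = augIdeal G`:

* the dyadic difference quotients `D_n u = 2ⁿ ((p_{2⁻ⁿ} ⋆ u)(1) - u(1)) = 2ⁿ (∫ u p_{2⁻ⁿ} - u(1))`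
  (`diffQuot`) converge on `R` (`exists_hasGenerator`, via the decomposition into joint
  eigenfunctions: on `𝓔_c`, `D_n u = 2ⁿ (c^{2⁻ⁿ} - 1) u(1) → log c · u(1)`); the limit is the
  **generating functional** `ψ_p = hp.gen` (the generator of the semigroup evaluated at `1`,
  Hunt 1956 §5), linear on `R` (`genR`, `genExt`), with `gen 1 = 0`;
* **symmetry** `gen ǔ = gen u` (`p_t(h⁻¹) = p_t(h)`) and **`Ad`-invariance**
  `gen (u(g · g⁻¹)) = gen u` (centrality);
* **positivity** `gen (a²) ≥ 0` for `a ∈ K` and the **Gaussian (locality) property**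
  `gen (a b c) = 0` for `a, b, c ∈ K` (`gen_mul_mul_eq_zero`, from `noJumps`): `ψ_p` is a
  symmetric `Ad`-invariant *quadratic form* on `K/K²`;
* **comparison**: if `gen_q (ab) = c₀ gen_p (ab)` on `K·K` then `gen_q = c₀ gen_p` on `R`
  (`gen_eq_mul_gen_of_aug`, by `eq_zero_of_symm_of_mul_aug`), hence `log d = c₀ log c` on every
  joint eigenspace, `q_s ⋆ = p_{c₀ s} ⋆` on `C(G, ℝ)` (density), and finally the
  **rescaling theorem** `eq_rescale_of_gen_eq`: `q_t = p_{c₀ t}` pointwise for all `t > 0`.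

What is left for `isGroupHeatKernel_unique_up_to_scale` after this file is exactly the Lie-type
statement that on a simple compact group two `Ad`-invariant positive Gaussian quadratic forms on
`K/K²` are proportional (next bricks). Sources: G. A. Hunt, Trans. AMS **81** (1956) §5
(Thm 5.1); M. Liao, *Lévy Processes in Lie Groups* (2004) §1.2, §4.4; E. M. Stein (1970)
Ch. II §2. No named facts; definitions `diffQuot`, `HasGenerator`, `gen`, `genR`, `genExt`.
-/

open MeasureTheory Filter Topology
open Literature.MathematicalPhysics.QuantumFieldTheory (haarProbability integral_haar_conj_eq)

noncomputable section


namespace Literature.MathematicalPhysics.QuantumLattice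

open Literature.RepresentationTheory.CompactGroups

variable {G : Type*} [Group G] [TopologicalSpace G] [IsTopologicalGroup G] [CompactSpace G]
  [MeasurableSpace G] [BorelSpace G]

/-- `0 < 1/2ⁿ`. [folklore] -/
theorem one_div_two_pow_pos (n : ℕ) : (0 : ℝ) < 1 / 2 ^ n := by positivity

/-- `1/2ⁿ → 0`. [folklore] -/
theorem tendsto_one_div_two_pow : Tendsto (fun n : ℕ => (1 : ℝ) / 2 ^ n) atTop (𝓝 0) := by
  simpa [div_eq_mul_inv] using tendsto_pow_atTop_nhds_zero_of_lt_one (r := (2 : ℝ)⁻¹)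
    (by positivity) (by norm_num)

/-- `1/2ⁿ → 0⁺`. [folklore] -/
theorem tendsto_one_div_two_pow_nhdsWithin :
    Tendsto (fun n : ℕ => (1 : ℝ) / 2 ^ n) atTop (𝓝[>] 0) :=
  tendsto_nhdsWithin_of_tendsto_nhds_of_eventually_within _ tendsto_one_div_two_pow
    (Eventually.of_forall one_div_two_pow_pos)

/-- **The derivative of `t ↦ c^t` at `0` along dyadics**: `2ⁿ (c^{2⁻ⁿ} - 1) → log c` (`c > 0`).
[folklore] -/
theorem tendsto_two_pow_mul_rpow_sub_one {c : ℝ} (hc : 0 < c) :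
    Tendsto (fun n : ℕ => 2 ^ n * (c ^ ((1 : ℝ) / 2 ^ n) - 1)) atTop (𝓝 (Real.log c)) := by
  have hd : HasDerivAt (fun x : ℝ => c ^ x) (Real.log c) 0 := by
    simpa using (Real.hasStrictDerivAt_const_rpow hc 0).hasDerivAt
  have hslope := hd.tendsto_slope_zero
  have hseq : Tendsto (fun n : ℕ => (1 : ℝ) / 2 ^ n) atTop (𝓝[≠] 0) :=
    tendsto_one_div_two_pow_nhdsWithin.mono_right (nhdsWithin_mono _ fun x hx => ne_of_gt hx)
  have := hslope.comp hseq
  refine this.congr fun n => ?_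
  simp only [Function.comp_apply, zero_add, Real.rpow_zero, one_div, inv_inv, smul_eq_mul]

namespace IsGroupHeatKernel

open scoped InnerProductSpace

variable {p : ℝ → G → ℝ}

/-! ### The difference quotients `2ⁿ (∫ u p_{2⁻ⁿ} - u(1))` and the generating functional -/

/-- The `n`-th dyadic difference quotient of the heat semigroup at the identity,
`D_n u = 2ⁿ ((p_{2⁻ⁿ} ⋆ u)(1) - u(1)) = 2ⁿ (∫ u p_{2⁻ⁿ} - u(1))`, a linear functional on
`C(G, ℝ)`. [folklore] -/
def diffQuot (hp : IsGroupHeatKernel p) (n : ℕ) : C(G, ℝ) →ₗ[ℝ] ℝ :=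
  (2 : ℝ) ^ n • ((evalOne G).comp (hp.convCM (one_div_two_pow_pos n) : C(G, ℝ) →ₗ[ℝ] C(G, ℝ)) -
    evalOne G)

/-- `D_n u = 2ⁿ ((p_{2⁻ⁿ} ⋆ u)(1) - u(1))`. [folklore] -/
theorem diffQuot_apply (hp : IsGroupHeatKernel p) (n : ℕ) (u : C(G, ℝ)) :
    hp.diffQuot n u = 2 ^ n * (haarConv (p (1 / 2 ^ n)) u 1 - u 1) := by
  simp [diffQuot]

/-- `D_n u = 2ⁿ (∫ u p_{2⁻ⁿ} - u(1))`. [folklore] -/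
theorem diffQuot_eq_integral (hp : IsGroupHeatKernel p) (n : ℕ) (u : C(G, ℝ)) :
    hp.diffQuot n u = 2 ^ n * (∫ h, u h * p (1 / 2 ^ n) h ∂(haarProbability G) - u 1) := by
  rw [diffQuot_apply, hp.integral_mul_eq_haarConv_one (one_div_two_pow_pos n)]

/-- `u` has generator value `a`: `D_n u → a`. [folklore] -/
def HasGenerator (hp : IsGroupHeatKernel p) (u : C(G, ℝ)) (a : ℝ) : Prop :=
  Tendsto (fun n => hp.diffQuot n u) atTop (𝓝 a)

/-- Generator values are unique. [folklore] -/
theorem HasGenerator.unique (hp : IsGroupHeatKernel p) {u : C(G, ℝ)} {a b : ℝ}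
    (ha : hp.HasGenerator u a) (hb : hp.HasGenerator u b) : a = b :=
  tendsto_nhds_unique ha hb

/-- Additivity of generator values. [folklore] -/
theorem HasGenerator.add (hp : IsGroupHeatKernel p) {u v : C(G, ℝ)} {a b : ℝ}
    (ha : hp.HasGenerator u a) (hb : hp.HasGenerator v b) : hp.HasGenerator (u + v) (a + b) := by
  have := Tendsto.add ha hb
  simpa only [HasGenerator, map_add] using this

/-- Homogeneity of generator values. [folklore] -/
theorem HasGenerator.smul (hp : IsGroupHeatKernel p) {u : C(G, ℝ)} {a : ℝ} (c : ℝ)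
    (ha : hp.HasGenerator u a) : hp.HasGenerator (c • u) (c * a) := by
  have := ha.const_mul c
  simpa only [HasGenerator, map_smul, smul_eq_mul] using this

/-- Finite sums of generator values. [folklore] -/
theorem HasGenerator.sum (hp : IsGroupHeatKernel p) {ι : Type*} (s : Finset ι)
    {u : ι → C(G, ℝ)} {a : ι → ℝ} (h : ∀ i ∈ s, hp.HasGenerator (u i) (a i)) :
    hp.HasGenerator (∑ i ∈ s, u i) (∑ i ∈ s, a i) := by
  have := tendsto_finsetSum s h
  simpa only [HasGenerator, map_sum] using this

/-- **Generator value of an eigenfunction**: for `u ∈ 𝓔_c`, `c > 0`,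
`D_n u = 2ⁿ (c^{2⁻ⁿ} - 1) u(1) → log c · u(1)`. [folklore] -/
theorem hasGenerator_of_mem_eigC [T2Space G] (hp : IsGroupHeatKernel p) {c : ℝ} (hc : 0 < c)
    {u : C(G, ℝ)} (hu : u ∈ hp.eigC c) : hp.HasGenerator u (Real.log c * u 1) := by
  have key : ∀ n, hp.diffQuot n u = 2 ^ n * (c ^ ((1 : ℝ) / 2 ^ n) - 1) * u 1 := by
    intro n
    rw [diffQuot_apply, ← hp.convCM_apply (one_div_two_pow_pos n),
      hp.convCM_eq_rpow_smul_of_mem_eigC hc hu (one_div_two_pow_pos n)]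
    simp only [ContinuousMap.smul_apply, smul_eq_mul]
    ring
  simp only [HasGenerator, key]
  exact (tendsto_two_pow_mul_rpow_sub_one hc).mul_const _

/-- The zero function has generator value `0`. [folklore] -/
theorem hasGenerator_zero (hp : IsGroupHeatKernel p) : hp.HasGenerator 0 0 := by
  simp only [HasGenerator, map_zero]; exact tendsto_const_nhds

/-- **Every translation-finite function has a generator value** (decompose into joint
eigenfunctions). [folklore] -/
theorem exists_hasGenerator [T2Space G] (hp : IsGroupHeatKernel p) {u : C(G, ℝ)}
    (hu : u ∈ translationFinite G) : ∃ a, hp.HasGenerator u a := by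
  obtain ⟨s, v, hv, rfl⟩ := hp.exists_sum_eq_of_isTranslationFinite hp hu
  have h : ∀ cd ∈ s, ∃ a, hp.HasGenerator (v cd) a := by
    intro cd _
    by_cases h0 : v cd = 0
    · exact ⟨0, by rw [h0]; exact hp.hasGenerator_zero⟩
    · have hne : toL2 G (v cd) ≠ 0 := fun h => h0 (toL2_injective (by rw [h, map_zero]))
      have hc : 0 < cd.1 := hp.eigenvalue_pos (hv cd).1 hne
      exact ⟨_, hp.hasGenerator_of_mem_eigC hc (hv cd).1⟩
  choose! a ha using h
  exact ⟨∑ cd ∈ s, a cd, HasGenerator.sum hp s ha⟩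

/-- **The generating functional** `ψ_p(u) = lim 2ⁿ (∫ u p_{2⁻ⁿ} - u(1))` of the heat kernel
(`= (A u)(1)` for the generator `A` of the semigroup; Hunt 1956 §5, Liao 2004 §1.2). Total
function; meaningful (the limit exists) on translation-finite `u`. [cite: Hunt1956, §5] -/
def gen (hp : IsGroupHeatKernel p) (u : C(G, ℝ)) : ℝ :=
  limUnder atTop fun n => hp.diffQuot n u

/-- `gen u` is the generator value when it exists. [folklore] -/
theorem HasGenerator.gen_eq (hp : IsGroupHeatKernel p) {u : C(G, ℝ)} {a : ℝ}
    (h : hp.HasGenerator u a) : hp.gen u = a :=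
  h.limUnder_eq

/-- On translation-finite functions, `D_n u → gen u`. [folklore] -/
theorem hasGenerator_gen [T2Space G] (hp : IsGroupHeatKernel p) {u : C(G, ℝ)}
    (hu : u ∈ translationFinite G) : hp.HasGenerator u (hp.gen u) := by
  obtain ⟨a, ha⟩ := hp.exists_hasGenerator hu
  rwa [ha.gen_eq]

/-- `gen` of an eigenfunction: `gen u = log c · u(1)` on `𝓔_c`, `c > 0`. [folklore] -/
theorem gen_eq_of_mem_eigC [T2Space G] (hp : IsGroupHeatKernel p) {c : ℝ} (hc : 0 < c)
    {u : C(G, ℝ)} (hu : u ∈ hp.eigC c) : hp.gen u = Real.log c * u 1 :=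
  (hp.hasGenerator_of_mem_eigC hc hu).gen_eq

/-- `gen` is additive on `R`. [folklore] -/
theorem gen_add [T2Space G] (hp : IsGroupHeatKernel p) {u v : C(G, ℝ)}
    (hu : u ∈ translationFinite G) (hv : v ∈ translationFinite G) :
    hp.gen (u + v) = hp.gen u + hp.gen v :=
  ((hp.hasGenerator_gen hu).add hp (hp.hasGenerator_gen hv)).gen_eq

/-- `gen` is homogeneous on `R`. [folklore] -/
theorem gen_smul [T2Space G] (hp : IsGroupHeatKernel p) (c : ℝ) {u : C(G, ℝ)}
    (hu : u ∈ translationFinite G) : hp.gen (c • u) = c * hp.gen u :=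
  ((hp.hasGenerator_gen hu).smul hp c).gen_eq

/-- `gen 0 = 0`. [folklore] -/
theorem gen_zero (hp : IsGroupHeatKernel p) : hp.gen 0 = 0 := hp.hasGenerator_zero.gen_eq

/-- `gen 1 = 0` (constants: `∫ p_t = 1`). [folklore] -/
theorem gen_one (hp : IsGroupHeatKernel p) : hp.gen 1 = 0 := by
  refine HasGenerator.gen_eq hp ?_
  have : ∀ n, hp.diffQuot n 1 = 0 := fun n => by
    rw [diffQuot_eq_integral]
    have h1 := hp.integral_eq_one _ (one_div_two_pow_pos n)
    simp only [ContinuousMap.one_apply, one_mul, h1, sub_self, mul_zero]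
  simp only [HasGenerator, this]
  exact tendsto_const_nhds

/-- **The generating functional as a linear map on `R = translationFinite G`.** [folklore] -/
def genR [T2Space G] (hp : IsGroupHeatKernel p) :
    Subalgebra.toSubmodule (translationFinite G) →ₗ[ℝ] ℝ where
  toFun u := hp.gen u
  map_add' u v := hp.gen_add u.2 v.2
  map_smul' c u := hp.gen_smul c u.2

/-- A linear extension of `ψ_p` from `R` to all of `C(G, ℝ)` (by a Hamel complement; only its
values on `R`, where it equals `gen`, are ever used). [folklore] -/
def genExt [T2Space G] (hp : IsGroupHeatKernel p) : C(G, ℝ) →ₗ[ℝ] ℝ :=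
  Classical.choose (LinearMap.exists_extend hp.genR)

/-- `genExt = gen` on `R`. [folklore] -/
theorem genExt_apply [T2Space G] (hp : IsGroupHeatKernel p) {u : C(G, ℝ)}
    (hu : u ∈ translationFinite G) : hp.genExt u = hp.gen u := by
  have h := Classical.choose_spec (LinearMap.exists_extend hp.genR)
  have := LinearMap.congr_fun h ⟨u, hu⟩
  simpa [genExt, genR] using this

/-! ### Invariance properties: symmetry and `Ad`-invariance -/

omit [MeasurableSpace G] [BorelSpace G] in
/-- `(k ⋆ ǔ)(1) = (k ⋆ u)(1)` for a symmetric kernel: both equal `∫ u k`. [folklore] -/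
theorem haarConv_invTrans_apply_one [MeasurableSpace G] [BorelSpace G] {k : G → ℝ}
    (hk : ∀ g, k g⁻¹ = k g) (u : C(G, ℝ)) :
    haarConv k (invTrans u) 1 = haarConv k u 1 := by
  rw [haarConv_apply_one_of_symm hk, haarConv_apply_one_of_symm hk,
    ← integral_inv_eq_self (fun h => u h * k h) (haarProbability G)]
  refine integral_congr_ae (Eventually.of_forall fun h => ?_)
  simp [hk]

/-- **Symmetry of the generating functional**: `gen ǔ = gen u` (`p_t(h⁻¹) = p_t(h)`). [folklore] -/
theorem gen_invTrans (hp : IsGroupHeatKernel p) (u : C(G, ℝ)) : hp.gen (invTrans u) = hp.gen u := by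
  have : ∀ n, hp.diffQuot n (invTrans u) = hp.diffQuot n u := fun n => by
    rw [diffQuot_apply, diffQuot_apply,
      haarConv_invTrans_apply_one (hp.symm _ (one_div_two_pow_pos n))]
    simp
  simp only [gen, this]

omit [MeasurableSpace G] [BorelSpace G] in
/-- `(k ⋆ u(g · g⁻¹))(1) = (k ⋆ u)(1)` for a central symmetric kernel. [folklore] -/
theorem haarConv_conj_apply_one [MeasurableSpace G] [BorelSpace G] {k : G → ℝ}
    (hk : ∀ g, k g⁻¹ = k g) (hkc : ∀ g h, k (h * g * h⁻¹) = k g) (u : C(G, ℝ)) (g : G) :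
    haarConv k (lTrans g (rTrans g⁻¹ u)) 1 = haarConv k u 1 := by
  rw [haarConv_apply_one_of_symm hk, haarConv_apply_one_of_symm hk,
    ← integral_haar_conj_eq (fun h => u h * k h) g g⁻¹]
  refine integral_congr_ae (Eventually.of_forall fun h => ?_)
  simp only [lTrans_apply, rTrans_apply]
  rw [hkc h g]

/-- **`Ad`-invariance of the generating functional**: `gen (u(g · g⁻¹)) = gen u` (centrality of
`p_t`). [folklore] -/
theorem gen_conj (hp : IsGroupHeatKernel p) (u : C(G, ℝ)) (g : G) :
    hp.gen (lTrans g (rTrans g⁻¹ u)) = hp.gen u := by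
  have : ∀ n, hp.diffQuot n (lTrans g (rTrans g⁻¹ u)) = hp.diffQuot n u := fun n => by
    rw [diffQuot_apply, diffQuot_apply, haarConv_conj_apply_one (hp.symm _ (one_div_two_pow_pos n))
      (hp.central _ (one_div_two_pow_pos n))]
    simp
  simp only [gen, this]

/-! ### Positivity and the Gaussian property -/

/-- For `w` vanishing at `1`, `D_n w = 2ⁿ ∫ w p_{2⁻ⁿ}`. [folklore] -/
theorem diffQuot_eq_of_apply_one (hp : IsGroupHeatKernel p) (n : ℕ) {w : C(G, ℝ)} (hw : w 1 = 0) :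
    hp.diffQuot n w = 2 ^ n * ∫ h, w h * p (1 / 2 ^ n) h ∂(haarProbability G) := by
  rw [diffQuot_eq_integral, hw, sub_zero]

/-- `D_n (a²) ≥ 0` for `a(1) = 0`. [folklore] -/
theorem diffQuot_sq_nonneg (hp : IsGroupHeatKernel p) (n : ℕ) {a : C(G, ℝ)} (ha : a 1 = 0) :
    0 ≤ hp.diffQuot n (a * a) := by
  rw [hp.diffQuot_eq_of_apply_one n (by simp [ha])]
  refine mul_nonneg (by positivity) (integral_nonneg fun h => ?_)
  exact mul_nonneg (mul_self_nonneg _) (hp.nonneg _ (one_div_two_pow_pos n) _)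

/-- **Positivity**: `gen (a²) ≥ 0` for `a ∈ K`. [folklore] -/
theorem gen_sq_nonneg [T2Space G] (hp : IsGroupHeatKernel p) {a : C(G, ℝ)} (ha : a ∈ augIdeal G) :
    0 ≤ hp.gen (a * a) :=
  ge_of_tendsto' (hp.hasGenerator_gen ((translationFinite G).mul_mem ha.1 ha.1))
    fun n => hp.diffQuot_sq_nonneg n (apply_one_of_mem_augIdeal ha)

/-- **Gaussian property of the generating functional** (Hunt 1956 §5: a convolution semigroup
with no jumps has a *local* generator): `gen (a b c) = 0` for `a, b, c ∈ K`. Proof: on the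
neighbourhood `U = {|c| < ε}` of `1`, `|abc| ≤ ε (a² + b²)/2`; off `U`, `|abc| ≤ C`; hence
`|D_n(abc)| ≤ (ε/2)(D_n(a²) + D_n(b²)) + C · 2ⁿ P_{2⁻ⁿ}(Uᶜ)`, and `2ⁿ P_{2⁻ⁿ}(Uᶜ) → 0` (`noJumps`)
while `D_n(a²) → gen(a²) < ∞`. [cite: Hunt1956, §5] -/
theorem gen_mul_mul_eq_zero [T2Space G] (hp : IsGroupHeatKernel p) {a b c : C(G, ℝ)}
    (ha : a ∈ augIdeal G) (hb : b ∈ augIdeal G) (hc : c ∈ augIdeal G) :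
    hp.gen (a * b * c) = 0 := by
  set w := a * b * c with hw_def
  have hw : w ∈ translationFinite G :=
    (translationFinite G).mul_mem ((translationFinite G).mul_mem ha.1 hb.1) hc.1
  have hw1 : w 1 = 0 := by simp [w, apply_one_of_mem_augIdeal hc]
  have haa : (a * a) 1 = 0 := by simp [apply_one_of_mem_augIdeal ha]
  have hbb : (b * b) 1 = 0 := by simp [apply_one_of_mem_augIdeal hb]
  have hlim : Tendsto (fun n => hp.diffQuot n w) atTop (𝓝 (hp.gen w)) := hp.hasGenerator_gen hw
  have hlimA : Tendsto (fun n => hp.diffQuot n (a * a)) atTop (𝓝 (hp.gen (a * a))) :=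
    hp.hasGenerator_gen ((translationFinite G).mul_mem ha.1 ha.1)
  have hlimB : Tendsto (fun n => hp.diffQuot n (b * b)) atTop (𝓝 (hp.gen (b * b))) :=
    hp.hasGenerator_gen ((translationFinite G).mul_mem hb.1 hb.1)
  have hA := hp.gen_sq_nonneg ha
  have hB := hp.gen_sq_nonneg hb
  obtain ⟨C, hC0, hC⟩ := exists_forall_abs_le_of_continuous w.continuous
  -- it suffices to bound `|gen w|` by `ε/2 (gen a² + gen b²)` for every `ε > 0`
  suffices key : ∀ ε, 0 < ε → |hp.gen w| ≤ ε / 2 * (hp.gen (a * a) + hp.gen (b * b)) by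
    by_contra hne
    have hpos : 0 < |hp.gen w| := abs_pos.mpr hne
    by_cases hS : hp.gen (a * a) + hp.gen (b * b) = 0
    · have := key 1 one_pos
      rw [hS, mul_zero] at this
      linarith
    · have hSpos : 0 < hp.gen (a * a) + hp.gen (b * b) :=
        lt_of_le_of_ne (add_nonneg hA hB) (Ne.symm hS)
      have h := key (|hp.gen w| / (hp.gen (a * a) + hp.gen (b * b))) (by positivity)
      have h' : |hp.gen w| / (hp.gen (a * a) + hp.gen (b * b)) / 2 *
          (hp.gen (a * a) + hp.gen (b * b)) = |hp.gen w| / 2 := by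
        field_simp
      linarith
  intro ε hε
  -- the neighbourhood `U = {|c| < ε}` of `1`
  set U : Set G := {h | |c h| < ε} with hU_def
  have hUo : IsOpen U := isOpen_lt (by fun_prop) continuous_const
  have hU1 : U ∈ 𝓝 (1 : G) := hUo.mem_nhds (by simp [hU_def, apply_one_of_mem_augIdeal hc, hε])
  have hUm : MeasurableSet U := hUo.measurableSet
  -- `J_n = 2ⁿ P_{2⁻ⁿ}(Uᶜ) → 0`
  have hJ : Tendsto (fun n : ℕ => (2 : ℝ) ^ n * ∫ h in Uᶜ, p (1 / 2 ^ n) h ∂(haarProbability G))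
      atTop (𝓝 0) := by
    have := (hp.noJumps U hU1).comp tendsto_one_div_two_pow_nhdsWithin
    refine this.congr fun n => ?_
    simp
  -- the basic inequality at level `n`
  have hineq : ∀ n, |hp.diffQuot n w| ≤ ε / 2 * (hp.diffQuot n (a * a) + hp.diffQuot n (b * b)) +
      C * ((2 : ℝ) ^ n * ∫ h in Uᶜ, p (1 / 2 ^ n) h ∂(haarProbability G)) := by
    intro n
    have ht := one_div_two_pow_pos n
    set t := (1 : ℝ) / 2 ^ n with ht_def
    rw [hp.diffQuot_eq_of_apply_one n hw1, hp.diffQuot_eq_of_apply_one n haa,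
      hp.diffQuot_eq_of_apply_one n hbb, abs_mul, abs_of_pos (by positivity : (0 : ℝ) < 2 ^ n)]
    have hpt := hp.continuous ht
    -- pointwise bound of the integrand
    have hbound : ∀ h, |w h * p t h| ≤ ε / 2 * ((a * a) h * p t h) + ε / 2 * ((b * b) h * p t h) +
        C * Set.indicator Uᶜ (p t) h := by
      intro h
      have hp0 := hp.nonneg t ht h
      rw [abs_mul, abs_of_nonneg hp0]
      by_cases hh : h ∈ U
      · rw [Set.indicator_of_notMem (fun hc' => (Set.mem_compl_iff U h).mp hc' hh), mul_zero,
          add_zero]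
        have hch : |c h| < ε := hh
        have h1 : |w h| ≤ ε / 2 * ((a * a) h + (b * b) h) := by
          have hab : |a h * b h| * 2 ≤ (a * a) h + (b * b) h := by
            simp only [ContinuousMap.mul_apply, abs_mul]
            nlinarith [sq_nonneg (|a h| - |b h|), sq_abs (a h), sq_abs (b h), abs_nonneg (a h),
              abs_nonneg (b h)]
          calc |w h| = |a h * b h| * |c h| := by simp [w, abs_mul]
            _ ≤ |a h * b h| * ε := mul_le_mul_of_nonneg_left hch.le (abs_nonneg _)
            _ = (|a h * b h| * 2) * (ε / 2) := by ring
            _ ≤ ((a * a) h + (b * b) h) * (ε / 2) :=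
                mul_le_mul_of_nonneg_right hab (by positivity)
            _ = ε / 2 * ((a * a) h + (b * b) h) := by ring
        calc |w h| * p t h ≤ ε / 2 * ((a * a) h + (b * b) h) * p t h :=
              mul_le_mul_of_nonneg_right h1 hp0
          _ = ε / 2 * ((a * a) h * p t h) + ε / 2 * ((b * b) h * p t h) := by ring
      · rw [Set.indicator_of_mem (Set.mem_compl hh)]
        have h2 : 0 ≤ ε / 2 * ((a * a) h * p t h) + ε / 2 * ((b * b) h * p t h) := by
          have : 0 ≤ (a * a) h * p t h := mul_nonneg (mul_self_nonneg _) hp0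
          have : 0 ≤ (b * b) h * p t h := mul_nonneg (mul_self_nonneg _) hp0
          positivity
        calc |w h| * p t h ≤ C * p t h := mul_le_mul_of_nonneg_right (hC h) hp0
          _ ≤ _ := le_add_of_nonneg_left h2
    have I1 : Integrable (fun h => (a * a) h * p t h) (haarProbability G) :=
      ((a * a).continuous.mul hpt).integrable_of_hasCompactSupport (HasCompactSupport.of_compactSpace _)
    have I2 : Integrable (fun h => (b * b) h * p t h) (haarProbability G) :=
      ((b * b).continuous.mul hpt).integrable_of_hasCompactSupport (HasCompactSupport.of_compactSpace _)
    have I3 : Integrable (fun h => Set.indicator Uᶜ (p t) h) (haarProbability G) :=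
      (hp.integrable ht).indicator hUm.compl
    have I1' : Integrable (fun h => ε / 2 * ((a * a) h * p t h)) (haarProbability G) :=
      I1.const_mul _
    have I2' : Integrable (fun h => ε / 2 * ((b * b) h * p t h)) (haarProbability G) :=
      I2.const_mul _
    have I3' : Integrable (fun h => C * Set.indicator Uᶜ (p t) h) (haarProbability G) :=
      I3.const_mul _
    have I12 : Integrable (fun h => ε / 2 * ((a * a) h * p t h) + ε / 2 * ((b * b) h * p t h))
        (haarProbability G) := I1'.add I2'
    have I123 : Integrable (fun h => ε / 2 * ((a * a) h * p t h) + ε / 2 * ((b * b) h * p t h) +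
        C * Set.indicator Uᶜ (p t) h) (haarProbability G) := I12.add I3'
    have key : |∫ h, w h * p t h ∂(haarProbability G)| ≤
        ε / 2 * (∫ h, (a * a) h * p t h ∂(haarProbability G) +
          ∫ h, (b * b) h * p t h ∂(haarProbability G)) +
        C * ∫ h in Uᶜ, p t h ∂(haarProbability G) := by
      calc |∫ h, w h * p t h ∂(haarProbability G)|
          ≤ ∫ h, |w h * p t h| ∂(haarProbability G) := abs_integral_le_integral_abs
        _ ≤ ∫ h, (ε / 2 * ((a * a) h * p t h) + ε / 2 * ((b * b) h * p t h) +
              C * Set.indicator Uᶜ (p t) h) ∂(haarProbability G) :=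
            integral_mono_of_nonneg (ae_of_all _ fun h => abs_nonneg _) I123 (ae_of_all _ hbound)
        _ = _ := by
            rw [integral_add I12 I3', integral_add I1' I2', integral_const_mul,
              integral_const_mul, integral_const_mul, integral_indicator hUm.compl]
            ring
    calc 2 ^ n * |∫ h, w h * p t h ∂(haarProbability G)|
        ≤ 2 ^ n * (ε / 2 * (∫ h, (a * a) h * p t h ∂(haarProbability G) +
            ∫ h, (b * b) h * p t h ∂(haarProbability G)) +
            C * ∫ h in Uᶜ, p t h ∂(haarProbability G)) := by gcongr
      _ = _ := by ring
  -- pass to the limit `n → ∞`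
  have hR : Tendsto (fun n => ε / 2 * (hp.diffQuot n (a * a) + hp.diffQuot n (b * b)) +
      C * ((2 : ℝ) ^ n * ∫ h in Uᶜ, p (1 / 2 ^ n) h ∂(haarProbability G))) atTop
      (𝓝 (ε / 2 * (hp.gen (a * a) + hp.gen (b * b)) + C * 0)) :=
    ((hlimA.add hlimB).const_mul _).add (hJ.const_mul C)
  rw [mul_zero, add_zero] at hR
  exact le_of_tendsto_of_tendsto' ((continuous_abs.tendsto _).comp hlim) hR hineq

/-- The generating functional kills `K·K·K`-type products in any bracketing: `gen (a (b c)) = 0`.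
[folklore] -/
theorem gen_mul_mul_eq_zero' [T2Space G] (hp : IsGroupHeatKernel p) {a b c : C(G, ℝ)}
    (ha : a ∈ augIdeal G) (hb : b ∈ augIdeal G) (hc : c ∈ augIdeal G) :
    hp.gen (a * (b * c)) = 0 := by
  rw [← mul_assoc]; exact hp.gen_mul_mul_eq_zero ha hb hc

/-! ### Comparison of two generating functionals and the rescaling theorem -/

/-- **Two generating functionals that are proportional on `K·K` are proportional on `R`**:
if `gen_q (ab) = c₀ gen_p (ab)` for all `a, b ∈ K` then `gen_q = c₀ gen_p` on `translationFinite G`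
(apply `eq_zero_of_symm_of_mul_aug` to the symmetric functional `genExt_q - c₀ genExt_p`).
[folklore] -/
theorem gen_eq_mul_gen_of_aug [T2Space G] {q : ℝ → G → ℝ} (hp : IsGroupHeatKernel p)
    (hq : IsGroupHeatKernel q) {c₀ : ℝ}
    (H : ∀ a ∈ augIdeal G, ∀ b ∈ augIdeal G, hq.gen (a * b) = c₀ * hp.gen (a * b)) :
    ∀ u ∈ translationFinite G, hq.gen u = c₀ * hp.gen u := by
  set φ : C(G, ℝ) →ₗ[ℝ] ℝ := hq.genExt - c₀ • hp.genExt with hφ_def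
  have hφ : ∀ u ∈ translationFinite G, φ u = hq.gen u - c₀ * hp.gen u := fun u hu => by
    simp only [hφ_def, LinearMap.sub_apply, LinearMap.smul_apply, hq.genExt_apply hu,
      hp.genExt_apply hu, smul_eq_mul]
  have hS : ∀ u ∈ translationFinite G, φ (invTrans u) = φ u := fun u hu => by
    rw [hφ u hu, hφ _ (invTrans_mem_translationFinite hu), hq.gen_invTrans, hp.gen_invTrans]
  have hK : ∀ a ∈ augIdeal G, ∀ b ∈ augIdeal G, φ (a * b) = 0 := fun a ha b hb => by
    rw [hφ _ ((translationFinite G).mul_mem ha.1 hb.1), H a ha b hb, sub_self]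
  have h1 : φ 1 = 0 := by
    rw [hφ 1 (translationFinite G).one_mem, hq.gen_one, hp.gen_one, mul_zero, sub_zero]
  intro u hu
  have := eq_zero_of_symm_of_mul_aug φ hS hK h1 u hu
  rw [hφ u hu] at this
  linarith

/-- If the generating functionals satisfy `gen_q = c₀ gen_p` on `R`, then on every non-trivial
joint eigenspace the eigenvalues satisfy `log d = c₀ log c` (evaluate at a translate which does
not vanish at `1`). [folklore] -/
theorem log_eq_of_gen_eq [T2Space G] {q : ℝ → G → ℝ} (hp : IsGroupHeatKernel p)
    (hq : IsGroupHeatKernel q) {c₀ : ℝ}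
    (H : ∀ u ∈ translationFinite G, hq.gen u = c₀ * hp.gen u) {c d : ℝ} {u : C(G, ℝ)}
    (hu : toL2 G u ∈ hp.eig c ⊓ hq.eig d) (hu0 : u ≠ 0) : Real.log d = c₀ * Real.log c := by
  have hne : toL2 G u ≠ 0 := fun h => hu0 (toL2_injective (by rw [h, map_zero]))
  have hc : 0 < c := hp.eigenvalue_pos hu.1 hne
  have hd : 0 < d := hq.eigenvalue_pos hu.2 hne
  obtain ⟨g, hg⟩ : ∃ g, u g ≠ 0 := by
    by_contra! h
    exact hu0 (ContinuousMap.ext h)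
  set u' := lTrans g u with hu'
  have hu'p : u' ∈ hp.eigC c := hp.lTrans_mem_eigC hu.1 g
  have hu'q : u' ∈ hq.eigC d := hq.lTrans_mem_eigC hu.2 g
  have h1 : u' 1 ≠ 0 := by simpa [hu'] using hg
  have hR : u' ∈ translationFinite G := hp.isTranslationFinite_of_mem_eigC hc.ne' hu'p
  have key := H u' hR
  rw [hq.gen_eq_of_mem_eigC hd hu'q, hp.gen_eq_of_mem_eigC hc hu'p, ← mul_assoc] at key
  exact mul_right_cancel₀ h1 key

/-- If `gen_q = c₀ gen_p` on `R` (`c₀ > 0`) then `q_s ⋆ u = p_{c₀ s} ⋆ u` for every continuous `u`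
and `s > 0` (equality on joint eigenfunctions via `d^s = c^{c₀ s}`, on `R` by decomposition, on
`C(G, ℝ)` by density). [folklore] -/
theorem convCM_eq_convCM_of_gen_eq [T2Space G] {q : ℝ → G → ℝ} (hp : IsGroupHeatKernel p)
    (hq : IsGroupHeatKernel q) {c₀ : ℝ} (hc₀ : 0 < c₀)
    (H : ∀ u ∈ translationFinite G, hq.gen u = c₀ * hp.gen u) {s : ℝ} (hs : 0 < s) :
    hq.convCM hs = hp.convCM (mul_pos hc₀ hs) := by
  -- on joint eigenfunctions
  have h1 : ∀ {c d : ℝ} {u : C(G, ℝ)}, toL2 G u ∈ hp.eig c ⊓ hq.eig d →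
      hq.convCM hs u = hp.convCM (mul_pos hc₀ hs) u := by
    intro c d u hu
    by_cases hu0 : u = 0
    · simp [hu0]
    have hne : toL2 G u ≠ 0 := fun h => hu0 (toL2_injective (by rw [h, map_zero]))
    have hc : 0 < c := hp.eigenvalue_pos hu.1 hne
    have hd : 0 < d := hq.eigenvalue_pos hu.2 hne
    have hlog := hp.log_eq_of_gen_eq hq H hu hu0
    rw [hq.convCM_eq_rpow_smul_of_mem_eigC hd hu.2 hs,
      hp.convCM_eq_rpow_smul_of_mem_eigC hc hu.1 (mul_pos hc₀ hs)]
    congr 1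
    rw [Real.rpow_def_of_pos hd, Real.rpow_def_of_pos hc, hlog]
    ring_nf
  -- on `R`
  have h2 : ∀ u ∈ translationFinite G, hq.convCM hs u = hp.convCM (mul_pos hc₀ hs) u := by
    intro u hu
    obtain ⟨S, v, hv, rfl⟩ := hp.exists_sum_eq_of_isTranslationFinite hq hu
    rw [map_sum, map_sum]
    exact Finset.sum_congr rfl fun cd _ => h1 (hv cd)
  -- on `C(G, ℝ)` by density
  have h3 : (hq.convCM hs : C(G, ℝ) → C(G, ℝ)) = hp.convCM (mul_pos hc₀ hs) :=
    Continuous.ext_on hp.dense_translationFinite (hq.convCM hs).continuous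
      (hp.convCM (mul_pos hc₀ hs)).continuous fun u hu => h2 u hu
  exact ContinuousLinearMap.coeFn_injective h3

/-- **Rescaling theorem.** If the generating functionals of two heat kernels `p`, `q` of `G`
satisfy `gen_q (ab) = c₀ gen_p (ab)` for all `a, b` in the augmentation ideal, with `c₀ > 0`,
then `q_t = p_{c₀ t}` pointwise for all `t > 0`: from `convCM_eq_convCM_of_gen_eq`,
`∫ u q_t = ∫ u p_{c₀ t}` for every continuous `u`, so `∫ (q_t - p_{c₀t})² = 0` and the continuous
function `q_t - p_{c₀ t}` vanishes (Haar measure charges open sets). This reduces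
`isGroupHeatKernel_unique_up_to_scale` to the proportionality of the two Gaussian quadratic forms
on `K/K²`. [folklore] -/
theorem eq_rescale_of_gen_eq [T2Space G] {q : ℝ → G → ℝ} (hp : IsGroupHeatKernel p)
    (hq : IsGroupHeatKernel q) {c₀ : ℝ} (hc₀ : 0 < c₀)
    (H : ∀ a ∈ augIdeal G, ∀ b ∈ augIdeal G, hq.gen (a * b) = c₀ * hp.gen (a * b)) :
    ∀ t, 0 < t → ∀ g, q t g = p (c₀ * t) g := by
  have HR := hp.gen_eq_mul_gen_of_aug hq H
  intro t ht
  have hct : 0 < c₀ * t := mul_pos hc₀ ht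
  have hop := hp.convCM_eq_convCM_of_gen_eq hq hc₀ HR ht
  -- equality of the pairings with every continuous function
  have hint : ∀ u : C(G, ℝ), ∫ h, u h * q t h ∂(haarProbability G) =
      ∫ h, u h * p (c₀ * t) h ∂(haarProbability G) := by
    intro u
    rw [hq.integral_mul_eq_haarConv_one ht, hp.integral_mul_eq_haarConv_one hct,
      ← hq.convCM_apply ht, ← hp.convCM_apply hct, hop]
  -- the continuous function `q_t - p_{c₀ t}` has `∫ (q_t - p_{c₀ t})² = 0`
  set u₀ : C(G, ℝ) := ⟨fun g => q t g - p (c₀ * t) g,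
    (hq.continuous ht).sub (hp.continuous hct)⟩ with hu₀
  have hsq : ∫ h, u₀ h * u₀ h ∂(haarProbability G) = 0 := by
    have h := hint u₀
    have I1 : Integrable (fun h => u₀ h * q t h) (haarProbability G) :=
      (u₀.continuous.mul (hq.continuous ht)).integrable_of_hasCompactSupport
        (HasCompactSupport.of_compactSpace _)
    have I2 : Integrable (fun h => u₀ h * p (c₀ * t) h) (haarProbability G) :=
      (u₀.continuous.mul (hp.continuous hct)).integrable_of_hasCompactSupport
        (HasCompactSupport.of_compactSpace _)
    have : ∫ h, u₀ h * u₀ h ∂(haarProbability G) =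
        ∫ h, u₀ h * q t h ∂(haarProbability G) - ∫ h, u₀ h * p (c₀ * t) h ∂(haarProbability G) := by
      rw [← integral_sub I1 I2]
      refine integral_congr_ae (Eventually.of_forall fun h => ?_)
      simp only [hu₀, ContinuousMap.coe_mk]
      ring
    rw [this, h, sub_self]
  have hzero : (fun h => u₀ h * u₀ h) = 0 := by
    have hnn : 0 ≤ᵐ[haarProbability G] fun h => u₀ h * u₀ h :=
      ae_of_all _ fun h => mul_self_nonneg _
    have hI : Integrable (fun h => u₀ h * u₀ h) (haarProbability G) :=
      (u₀.continuous.mul u₀.continuous).integrable_of_hasCompactSupport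
        (HasCompactSupport.of_compactSpace _)
    have hae := (integral_eq_zero_iff_of_nonneg_ae hnn hI).mp hsq
    exact (Continuous.ae_eq_iff_eq (haarProbability G) (u₀.continuous.mul u₀.continuous)
      continuous_const).mp hae
  intro g
  have := congrFun hzero g
  simp only [Pi.zero_apply, mul_self_eq_zero, hu₀, ContinuousMap.coe_mk] at this
  linarith

end IsGroupHeatKernel

end Literature.MathematicalPhysics.QuantumLattice
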